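/-
Copyright (c) 2026 the pub-hodgecm-mathlib formalisation cell (harness21).  Prover seat hodgecm-mathlib-F0P3a-p03 (g14), 2026-09-01.  Road «S3-tree» (census «S3» v3
0ca147ac, architect A-p16 (g28), ruling A-52): END-0, the LOCAL FOLD AT THE IDENTITY of the END contract `S3TreeEndContract` (HOME `F0/P3a/F0P3a-p03/g14/contract/`).
-/
import Literature.NumberTheory.Rogawski1990.LocalTransferGlue   -- ★ p839807 B-p08 (g25): `IsDeltaTransferRel` currency (★ `LocalTransfer`), `IsDeltaTransferRel.add∕finset_sum`, the global glue `exists_transfer_of_cover`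
import HarnessLib

/-!
# The non-archimedean glue LOCALISED AT THE IDENTITY: a `Δ`-transfer of `φ` on a neighbourhood of `1 ∈ H` from `Δ`-transfers of finitely many pieces on their own
# neighbourhoods of `1` (Rogawski 1990 §4.3 (4.3.1), §4.9 Prop. 4.9.1 (a); Langlands–Shelstad 1990 (2.1.2) «transfer at the identity»)

Topic `NumberTheory/Rogawski1990`; namespace `Literature.NumberTheory.Rogawski1990`.  THEOREMS ONLY (no definition, no instance, no notation, no named fact, no `sorry`); GENERIC
(groups `A`, `B`; `A` a topological group-carrier — the `H`-side of ★ `IsDeltaTransferRel`).  Cell `pub/hodgecm-mathlib` (D-0151), crux H413, line «N6nsGerm» last stub `stub_N6nsS3id`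
(S3 at the identity, [LanglandsShelstad1990Descent (2.1.2)]); road «S3-tree» (architect A-p16 (g28), census «S3» v3 0ca147ac; ruling A-52 «statement-first END contract»); seat F0P3a-p03
(g14) = END HEAD.  This is END-0 of the contract `S3TreeEndContract` (v0 8ae112bb, HOME): the sibling AT A POINT of ★ B-p08's global glue `exists_transfer_of_cover`.
HONEST LABEL: HC_CM is proved only modulo the printed citations (2 remaining named inputs hLiu418 24832, h413 24833) until rung 0 closes; pure bookkeeping, nothing printed is asserted.

THE MATHEMATICS.  «`φ` has a `Δ`-transfer near `1`» = `∃ V ∈ 𝓝 (1 : A), ∃ φ^H ∈ PH, IsDeltaTransferRel R st ((· ∈ V) ∧ reg) T m_H m_G φ^H φ` — ★ `IsDeltaTransferRel` (★ `LocalTransfer`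
:202: `∀ a, regA a → Φ^st(a, φ^H) = Σᶠ_c Δ(a, out c)·Φ(c, φ)`) with the regular set SHRUNK to a neighbourhood `V` of the identity; this is, definitionally, the body of the S3-at-the-identity
letter `stub_N6nsS3id` (crux workfile «N6nsGerm» ED. 1.15).  If finitely many pieces `g i` have `Δ`-transfers `g_i^H ∈ PH` on neighbourhoods `V_i`, and on some `V₀` the `Δ`-weighted
orbital sums of `φ` are the sum of those of the pieces, then `φ^H := Σ_i g_i^H` is a `Δ`-transfer of `φ` on `V₀ ∩ ⋂_i V_i` — provided `PH ∋ 0` is closed under `+` and the stable orbital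
integrals `Φ^st(a, ·)` are additive on `PH` at the regular points (for the CM carriers and CANONICAL families: ★ `localStableOrbitalIntegralH_add_of_isLocSmooth` ∘ ★
`IsCanonical.isAdmissibleOn`).  No `B`-side additivity is needed: the piece identity is a hypothesis (the road's «SPAN» brick delivers it from the tree counts).

* `IsDeltaTransferRel.mono_reg` — shrinking the regular set keeps a transfer pair.
* `exists_nhds_isDeltaTransferRel_of_pieces` — END-0, the local fold at the identity.

## References
* [Rogawski1990] J. D. Rogawski, *Automorphic Representations of Unitary Groups in Three Variables*, Ann. of Math. Stud. 123 (1990): §4.3 (4.3.1) p. 43; §4.9 Prop. 4.9.1 (a) pp. 54–55.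
* [LanglandsShelstad1990Descent] R. P. Langlands, D. Shelstad, *Descent for transfer factors*, The Grothendieck Festschrift II (1990): §2.1 (2.1.2).
* [LanglandsShelstad1987] R. P. Langlands, D. Shelstad, *On the definition of transfer factors*, Math. Ann. 278 (1987): §1.3–1.4.
-/

set_option autoImplicit false

noncomputable section

open Set Filter Topology MeasureTheory

namespace Literature.NumberTheory.Rogawski1990

open Literature.NumberTheory.Automorphic

section EndFold

variable {A B : Type*} [Group A] [Group B] [TopologicalSpace A]
  [∀ a : A, MeasurableSpace (A ⧸ Subgroup.centralizer ({a} : Set A))]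
  [∀ b : B, MeasurableSpace (B ⧸ Subgroup.centralizer ({b} : Set B))]

omit [TopologicalSpace A] in
/-- `IsDeltaTransferRel` is antitone in the regular set: shrinking `regA` keeps a transfer pair. [cite: Rogawski1990, §4.3 (4.3.1) p. 43] -/
theorem IsDeltaTransferRel.mono_reg {R : A → B → Prop} {stA : A → A → Prop} {regA regA' : A → Prop} {T : TransferFactorData A B R}
    {mH : OrbitalMeasureFamily A} {mG : OrbitalMeasureFamily B} {fH : A → ℂ} {f : B → ℂ}
    (h : IsDeltaTransferRel R stA regA T mH mG fH f) (hle : ∀ a, regA' a → regA a) :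
    IsDeltaTransferRel R stA regA' T mH mG fH f :=
  fun a ha => h a (hle a ha)

/-- **END-0 — THE LOCAL FOLD AT THE IDENTITY.**  `A` (the `H`-side) a topological group, `PH ∋ 0` a class of test functions on `A` closed under `+` on which the stable
orbital integrals are additive at the `regA`-points (`hA`).  If finitely many pieces `g i` (`i ∈ s`) each have a `Δ`-transfer in `PH` on SOME neighbourhood of `1`
(`hg : ∃ V ∈ 𝓝 1, ∃ gH, PH gH ∧ IsDeltaTransferRel R stA ((· ∈ V) ∧ regA) T mH mG gH (g i)`), and the `Δ`-weighted orbital sums of `φ` equal the sum of those of the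
pieces on some neighbourhood of `1` (`hφ`), then `φ` has a `Δ`-transfer in `PH` on a neighbourhood of `1`: `φ^H := Σ_{i ∈ s} (g i)^H` on `V := V_φ ∩ ⋂_i V_i`.
[cite: Rogawski1990, §4.3 (4.3.1) p. 43; §4.9 Prop. 4.9.1 (a) p. 55] [cite: LanglandsShelstad1990Descent, §2.1 (2.1.2)] -/
theorem exists_nhds_isDeltaTransferRel_of_pieces {R : A → B → Prop} {stA : A → A → Prop} {regA : A → Prop} {T : TransferFactorData A B R}
    {mH : OrbitalMeasureFamily A} {mG : OrbitalMeasureFamily B}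
    (PH : (A → ℂ) → Prop) (hPH0 : PH 0) (hPHadd : ∀ F G, PH F → PH G → PH (F + G))
    (hA : ∀ a, regA a → ∀ F G, PH F → PH G →
      stableOrbitalIntegralRel stA mH (F + G) a = stableOrbitalIntegralRel stA mH F a + stableOrbitalIntegralRel stA mH G a)
    {ι : Type*} (s : Finset ι) (g : ι → B → ℂ) (φ : B → ℂ)
    (hg : ∀ i ∈ s, ∃ V ∈ 𝓝 (1 : A), ∃ gH : A → ℂ, PH gH ∧ IsDeltaTransferRel R stA (fun a => a ∈ V ∧ regA a) T mH mG gH (g i))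
    (hφ : ∃ V ∈ 𝓝 (1 : A), ∀ a ∈ V, regA a →
      (∑ᶠ c : ConjClasses B, T.Δ a (Quotient.out c) * classOrbitalIntegral mG φ c) =
        ∑ i ∈ s, ∑ᶠ c : ConjClasses B, T.Δ a (Quotient.out c) * classOrbitalIntegral mG (g i) c) :
    ∃ V ∈ 𝓝 (1 : A), ∃ φH : A → ℂ, PH φH ∧ IsDeltaTransferRel R stA (fun a => a ∈ V ∧ regA a) T mH mG φH φ := by
  classical
  obtain ⟨V₀, hV₀, hφ₀⟩ := hφ
  choose! V hV gH hgH hT using hg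
  refine ⟨V₀ ∩ ⋂ i ∈ s, V i, Filter.inter_mem hV₀ ((Filter.biInter_finset_mem s).2 fun i hi => hV i hi), ∑ i ∈ s, gH i, ?_, ?_⟩
  · -- `PH` is closed under finite sums
    clear hT hφ₀
    induction s using Finset.induction_on with
    | empty => rw [Finset.sum_empty]; exact hPH0
    | insert i s hi ih =>
      rw [Finset.sum_insert hi]
      exact hPHadd _ _ (hgH i (Finset.mem_insert_self i s)) (ih (fun j hj => hV j (Finset.mem_insert_of_mem hj))
        (fun j hj => hgH j (Finset.mem_insert_of_mem hj)))
  · intro a ha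
    obtain ⟨haV, hareg⟩ := ha
    have haV₀ : a ∈ V₀ := haV.1
    have haVi : ∀ i ∈ s, a ∈ V i := fun i hi => Set.mem_iInter₂.1 haV.2 i hi
    rw [hφ₀ a haV₀ hareg]
    -- additivity of the stable orbital integrals over the pieces, and the piecewise transfers
    have hsum : ∀ t : Finset ι, t ⊆ s →
        stableOrbitalIntegralRel stA mH (∑ i ∈ t, gH i) a = ∑ i ∈ t, stableOrbitalIntegralRel stA mH (gH i) a ∧ PH (∑ i ∈ t, gH i) := by
      intro t ht
      induction t using Finset.induction_on with
      | empty => exact ⟨by rw [Finset.sum_empty, Finset.sum_empty, stableOrbitalIntegralRel_zero], by rw [Finset.sum_empty]; exact hPH0⟩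
      | insert i t hi ih =>
        obtain ⟨ih1, ih2⟩ := ih ((Finset.subset_insert i t).trans ht)
        have hi' : i ∈ s := ht (Finset.mem_insert_self i t)
        rw [Finset.sum_insert hi, Finset.sum_insert hi, hA a hareg _ _ (hgH i hi') ih2, ih1]
        exact ⟨rfl, hPHadd _ _ (hgH i hi') ih2⟩
    rw [(hsum s (Finset.Subset.refl s)).1]
    exact Finset.sum_congr rfl fun i hi => hT i hi a ⟨haVi i hi, hareg⟩

end EndFold

/-! ## §2 (ED. 2) END-0′ — a FIXED linear combination of `H`-side test functions is a transfer (the «2χ reading» of road «S3-tree», architect A-58 (iii)) -/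

section Linear

variable {A B : Type*} [Group A] [Group B]
  [∀ a : A, MeasurableSpace (A ⧸ Subgroup.centralizer ({a} : Set A))]
  [∀ b : B, MeasurableSpace (B ⧸ Subgroup.centralizer ({b} : Set B))]

/-- **END-0′ — A LINEAR COMBINATION OF FIXED `H`-FUNCTIONS IS A TRANSFER.**  If on the regular set the `Δ`-weighted orbital sums of `g` equal `Σ_i a_i · Φ^st(·, χ_i)` for
`χ_i ∈ PH`, then `Σ_i a_i • χ_i ∈ PH` and `(Σ_i a_i • χ_i, g)` is a `Δ`-transfer pair — given `PH ∋ 0` closed under `+` and scalars, `Φ^st(a, ·)` additive on `PH` at the regular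
points (`hA`) and homogeneous (`hS`; for the tree's `Φ^st` this is ★ `stableOrbitalIntegralRel_smul_fun`, unconditional).  Road «S3-tree» contract v2 (HOME `F0/P3a/F0P3a-p03/g14/contract/`,
8bf60abf) §1: the fold `gen_of_genChi` of the stub «GEN-χ» (every piece's `Δ‴`-sums near `1` lie in the span of `Φ^st(·, χ₀), Φ^st(·, χ₁)`, the co-reader's depth-zero class functions).
[cite: Rogawski1990, §4.3 (4.3.1) p. 43; §8.1 Prop. 8.1.1 p. 112] [cite: LanglandsShelstad1990Descent, §2.1 (2.1.2)] -/
theorem isDeltaTransferRel_sum_smul_of_eq {R : A → B → Prop} {stA : A → A → Prop} {regA : A → Prop} {T : TransferFactorData A B R}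
    {mH : OrbitalMeasureFamily A} {mG : OrbitalMeasureFamily B}
    (PH : (A → ℂ) → Prop) (hPH0 : PH 0) (hPHadd : ∀ F G, PH F → PH G → PH (F + G)) (hPHsmul : ∀ (c : ℂ) F, PH F → PH (c • F))
    (hA : ∀ a, regA a → ∀ F G, PH F → PH G →
      stableOrbitalIntegralRel stA mH (F + G) a = stableOrbitalIntegralRel stA mH F a + stableOrbitalIntegralRel stA mH G a)
    (hS : ∀ a (c : ℂ) F, stableOrbitalIntegralRel stA mH (c • F) a = c * stableOrbitalIntegralRel stA mH F a)
    {r : ℕ} (χ : Fin r → A → ℂ) (hχ : ∀ i, PH (χ i)) (coef : Fin r → ℂ) (g : B → ℂ)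
    (h : ∀ a, regA a → (∑ᶠ c : ConjClasses B, T.Δ a (Quotient.out c) * classOrbitalIntegral mG g c) = ∑ i, coef i * stableOrbitalIntegralRel stA mH (χ i) a) :
    PH (∑ i, coef i • χ i) ∧ IsDeltaTransferRel R stA regA T mH mG (∑ i, coef i • χ i) g := by
  classical
  have hsum : ∀ (s : Finset (Fin r)) (a : A), regA a →
      PH (∑ i ∈ s, coef i • χ i) ∧ stableOrbitalIntegralRel stA mH (∑ i ∈ s, coef i • χ i) a = ∑ i ∈ s, coef i * stableOrbitalIntegralRel stA mH (χ i) a := by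
    intro s a ha
    induction s using Finset.induction_on with
    | empty => exact ⟨by rw [Finset.sum_empty]; exact hPH0, by rw [Finset.sum_empty, Finset.sum_empty, stableOrbitalIntegralRel_zero]⟩
    | insert i s hi ih =>
      obtain ⟨ih1, ih2⟩ := ih
      refine ⟨by rw [Finset.sum_insert hi]; exact hPHadd _ _ (hPHsmul _ _ (hχ i)) ih1, ?_⟩
      rw [Finset.sum_insert hi, Finset.sum_insert hi, hA a ha _ _ (hPHsmul _ _ (hχ i)) ih1, hS, ih2]
  have hPHall : PH (∑ i, coef i • χ i) := by
    induction (Finset.univ : Finset (Fin r)) using Finset.induction_on with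
    | empty => rw [Finset.sum_empty]; exact hPH0
    | insert i s hi ih => rw [Finset.sum_insert hi]; exact hPHadd _ _ (hPHsmul _ _ (hχ i)) ih
  exact ⟨hPHall, fun a ha => by rw [(hsum Finset.univ a ha).2, h a ha]⟩

end Linear

end Literature.NumberTheory.Rogawski1990

end
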